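import Literature.NumberTheory.LFunctions.LogIntegralProofs
import HarnessLib

/-!
# Discharge of `Literature.NumberTheory.LFunctions.logIntegral_sub_logIntegral_two`: the bridge `li x − li 2 = Li x`

D-0014 keeps `Literature/` sorry-free by stating cited results as named facts `def X : Prop`.
This sibling file of `Literature.NumberTheory.LFunctions.LogIntegral` proves the named fact
`Literature.NumberTheory.LFunctions.logIntegral_sub_logIntegral_two` — `li x − li 2 = Li x` for `x > 1`, the bridge between the
two conventions `li x = ⨍₀ˣ dt/ln t` and `Li x = ∫₂ˣ dt/ln t` — as
`theorem logIntegral_sub_logIntegral_two_holds`; users holding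
`(h : logIntegral_sub_logIntegral_two)` are fed `logIntegral_sub_logIntegral_two_holds`.

Source. Abramowitz–Stegun 5.1.3 defines `li x = ⨍₀ˣ dt/ln t = Ei (ln x)` (`x > 1`), and 5.1.10
gives `Ei x = γ + ln x + ∑_{n ≥ 1} xⁿ/(n · n!)` (`x > 0`); `Literature.NumberTheory.LFunctions.logIntegral` is *defined* by this
series at `ln x`. For an integral definition the bridge `li x − li 2 = ∫₂ˣ dt/ln t` is
additivity of the integral; for the series definition it is the fundamental theorem of calculus
applied to `li' x = 1/ln x` on `[2, x] ⊆ (1, ∞)` — the derivative being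
`d/dx Ei (ln x) = e^{ln x}/(x ln x) = 1/ln x` (term-wise differentiation of 5.1.10,
`Literature.NumberTheory.LFunctions.hasDerivAt_logIntegral_holds` in `LogIntegralProofs`). The integrand `1/ln t` is
continuous on `[2, x]`, hence interval integrable (`Literature.NumberTheory.LFunctions.intervalIntegrable_inv_log_pow`).

## References

* M. Abramowitz, I. A. Stegun (eds.), *Handbook of Mathematical Functions*, National Bureau of
  Standards Applied Mathematics Series 55 (1964), §5.1, formulas 5.1.3 and 5.1.10.
  [cite: AbramowitzStegun1964]
-/

noncomputable section

open Real Filter Set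

namespace Literature.NumberTheory.LFunctions

section LogIntegralSubLogIntegralTwo

/-- The bridge between the two conventions in explicit form: `li x − li 2 = Li x = ∫₂ˣ dt/log t`
for `x > 1` (Abramowitz–Stegun 5.1.3, `li x = ⨍₀ˣ dt/ln t = Ei (ln x)`), by the fundamental
theorem of calculus (`intervalIntegral.integral_eq_sub_of_hasDerivAt`) for `li' = 1/log`
(`hasDerivAt_logIntegral_holds`) on `[[2, x]] ⊆ (1, ∞)`. [cite: AbramowitzStegun1964, 5.1.3] -/
theorem logIntegral_sub_logIntegral_two_of_one_lt {x : ℝ} (hx : 1 < x) :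
    logIntegral x - logIntegral 2 = offsetLogIntegral x := by
  have hderiv : ∀ t ∈ uIcc (2 : ℝ) x, HasDerivAt logIntegral (Real.log t)⁻¹ t := by
    intro t ht
    refine hasDerivAt_logIntegral_holds ?_
    rcases Set.mem_uIcc.1 ht with h | h <;> linarith [h.1]
  have hint : IntervalIntegrable (fun t : ℝ => (Real.log t)⁻¹) MeasureTheory.volume 2 x := by
    simpa using intervalIntegrable_inv_log_pow 1 one_lt_two hx
  have hftc : offsetLogIntegral x = logIntegral x - logIntegral 2 :=
    intervalIntegral.integral_eq_sub_of_hasDerivAt hderiv hint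
  exact hftc.symm

/-- **Discharge of `Literature.NumberTheory.LFunctions.logIntegral_sub_logIntegral_two`**: `li x − li 2 = Li x` for `x > 1`
(Abramowitz–Stegun 5.1.3 with 5.1.10). [cite: AbramowitzStegun1964, 5.1.3] -/
theorem logIntegral_sub_logIntegral_two_holds : logIntegral_sub_logIntegral_two :=
  fun hx => logIntegral_sub_logIntegral_two_of_one_lt hx

/-- The same bridge solved for `li`: `li x = Li x + li 2` for `x > 1`
(Abramowitz–Stegun 5.1.3). [cite: AbramowitzStegun1964, 5.1.3] -/
theorem logIntegral_eq_offsetLogIntegral_add_logIntegral_two {x : ℝ} (hx : 1 < x) :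
    logIntegral x = offsetLogIntegral x + logIntegral 2 := by
  rw [← logIntegral_sub_logIntegral_two_of_one_lt hx, sub_add_cancel]

/-- `li − Li` is eventually the constant `li 2` at `+∞` (Abramowitz–Stegun 5.1.3).
[cite: AbramowitzStegun1964, 5.1.3] -/
theorem logIntegral_sub_offsetLogIntegral_eventuallyEq :
    (fun x => logIntegral x - offsetLogIntegral x) =ᶠ[atTop] fun _ => logIntegral 2 := by
  filter_upwards [eventually_gt_atTop (1 : ℝ)] with x hx
  rw [logIntegral_eq_offsetLogIntegral_add_logIntegral_two hx, add_sub_cancel_left]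

end LogIntegralSubLogIntegralTwo

end Literature.NumberTheory.LFunctions
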